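import Mathlib
import Summits.PneNP.PneNP.Theorems.OverlapGapAlgebraSearchHardWindowLipschitzRungDegree
import Summits.PneNP.PneNP.Theorems.OverlapGapAlgebraSearchHardWindowLipschitzRungVariance

/-!
# PneNP / OverlapGapAlgebra — `SearchHardWindow`, the strong Lipschitz rung (3/4): the rung

Support for crux `stmt-PneNP-2460` (`Summit.PneNP.PneNP.Theses.OverlapGapAlgebra.SearchHardWindow`):
its hardness conjunct (success probability `→ 0` at `α_k = 5·2^k log k / k`) for the class of search
maps that are **Lipschitz** — at most `s(n)` output bits change when one literal of the instance is
resampled, `s(n)² log³ n = o(n)` (so `s` constant, polylogarithmic, or up to `√n / log^{3/2+o(1)} n`) —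
MODULO the smooth-maps-fail statement of the route (the conclusion of
`smoothMapsFail_of_noStableSection`, escalated seat 1, itself Bresler–Huang 2021 Thm 2.6 in the
authors' general form modulo crux `NoStableSection`, stmt-PneNP-2462): for fixed `k, η, ν, c` it says
that a map with few `ηn`-jumps is NOT `ν`-valid outside a `c n /(k m log 2n)`-fraction of instances.
* `shwLip_successCount_le_of_smoothFail` — smooth-fail at `(k, η, ν, c)` ⟹ for every `s = o(√n/log^{3/2} n)`
  and `ε > 0`, eventually every `s(n)`-Lipschitz `g` solves at most an `ε`-fraction of `F_k(n, ⌊α_k n⌋)`.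
  Mechanism (new here; the weak Lipschitz corollary of seat 1 only excludes success `1 - Θ(1/log n)`,
  the regime of BH21 Thm 2.6): for Lipschitz maps validity SELF-CONCENTRATES at Chebyshev level —
  Efron–Stein (`shwLip_sum_sq_dev_le`) with the max clause-degree second moment
  (`shwL_sum_maxdeg_sq_le`) gives `Var(#violated) = O(m (1 + s² log² n))`; success `≥ ε` boosts the
  mean to `o(n)` and Chebyshev makes the `ν m`-invalid density `O((1 + s² log² n)/n)`, below the
  walk-lemma budget `Θ(1/log n)` of the smooth-fail statement (`shwLip_card_gt_le_of_zeroSet`).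
* `shwLip_lipschitzMapsFail_of_smoothMapsFail` — the same packaged over `k ≥ k₀` with the smooth-fail
  statement quantified exactly as seat 1 concludes it (so `… (smoothMapsFail_of_noStableSection hNo)`
  is the rung modulo `NoStableSection` alone).
(The crux-language corollaries and the versions modulo `NoStableSection` alone are in
`OverlapGapAlgebraSearchHardWindowLipschitzRungCrux.lean`.)
Honest scope: in print BH21 prove failure of LOCAL algorithms at tiny success probability by strong
concentration (Thm 2.13) and of low-degree polynomials at success `1 - n^{-Ω(1)}` (Thm 2.6); the
Lipschitz class here sits between (deterministic stability, no locality/isomorphism-invariance), and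
the point is that second-moment concentration already suffices against the walk-lemma budget.
No new definitions; axioms `propext`, `Classical.choice`, `Quot.sound`.
-/

set_option linter.dupNamespace false -- `Summit.PneNP.PneNP.…`: summit = sub-problem (D-0017)

namespace Summit.PneNP.PneNP.Theorems

open Finset Filter Asymptotics
open scoped Classical

/-- **Strong Lipschitz rung, modulo smooth-fail at `(k, η, ν, c)`.** If, eventually in `n`, every map
`g` on `F_k(n, ⌊α_k n⌋)` with `ηn`-jump mass at most `c n/log(2n) · #inst · 2n` is `ν m`-invalid on MORE
than a `c n /(k m log 2n)`-fraction of instances (the smooth-maps-fail statement), then for every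
`s` with `s(n)² log³ n = o(n)` and every `ε > 0`, eventually every map that is `s(n)`-Lipschitz in
Hamming output per single-literal change solves at most an `ε`-fraction of the instances. -/
theorem shwLip_successCount_le_of_smoothFail (k : ℕ) (η ν c : ℝ) (hη : 0 < η) (hν : 0 < ν)
    (hc : 0 < c)
    (hSF : ∀ᶠ n : ℕ in atTop, ∀ m : ℕ, m = ⌊5 * 2 ^ k * Real.log k / k * n⌋₊ →
      ∀ g : (Fin m → Fin k → Fin n × Bool) → (Fin n → Bool),
        (∑ a : Fin m, ∑ b : Fin k,
          (((Finset.univ : Finset ((Fin m → Fin k → Fin n × Bool) × (Fin n × Bool))).filter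
            fun p => η * n < hammingDist (g p.1)
              (g (Function.update p.1 a (Function.update (p.1 a) b p.2)))).card : ℝ))
          ≤ c * n / Real.log (2 * n) * (Fintype.card (Fin m → Fin k → Fin n × Bool) * (2 * n)) →
        c * n / Real.log (2 * n) * Fintype.card (Fin m → Fin k → Fin n × Bool)
          < (k * m : ℕ) * ((Finset.univ.filter fun Φ : Fin m → Fin k → Fin n × Bool =>
              ν * m < ((Finset.univ.filter fun i : Fin m =>
                ∀ j, g Φ (Φ i j).1 ≠ (Φ i j).2).card : ℝ)).card : ℝ))
    (s : ℕ → ℝ) (hs : (fun n : ℕ => s n ^ 2 * Real.log n ^ 3) =o[atTop] (fun n : ℕ => (n : ℝ)))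
    (ε : ℝ) (hε : 0 < ε) :
    ∀ᶠ n : ℕ in atTop, ∀ m : ℕ, m = ⌊5 * 2 ^ k * Real.log k / k * n⌋₊ →
      ∀ g : (Fin m → Fin k → Fin n × Bool) → (Fin n → Bool),
        (∀ (Φ : Fin m → Fin k → Fin n × Bool) (a : Fin m) (b : Fin k) (ℓ : Fin n × Bool),
          (hammingDist (g Φ) (g (Function.update Φ a (Function.update (Φ a) b ℓ))) : ℝ) ≤ s n) →
        ((Finset.univ.filter fun Φ : Fin m → Fin k → Fin n × Bool =>
            ∀ i, ∃ j, g Φ (Φ i j).1 = (Φ i j).2).card : ℝ)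
          ≤ ε * Fintype.card (Fin m → Fin k → Fin n × Bool) := by
  set α : ℝ := 5 * 2 ^ k * Real.log k / k with hαdef
  -- the jump-mass hypothesis of smooth-fail is free once `s n ≤ η n`
  have hjump : ∀ (n m : ℕ) (g : (Fin m → Fin k → Fin n × Bool) → (Fin n → Bool)),
      (∀ (Φ : Fin m → Fin k → Fin n × Bool) (a : Fin m) (b : Fin k) (ℓ : Fin n × Bool),
        (hammingDist (g Φ) (g (Function.update Φ a (Function.update (Φ a) b ℓ))) : ℝ) ≤ s n) →
      s n ≤ η * n → 1 ≤ n →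
      (∑ a : Fin m, ∑ b : Fin k,
          (((Finset.univ : Finset ((Fin m → Fin k → Fin n × Bool) × (Fin n × Bool))).filter
            fun p => η * n < hammingDist (g p.1)
              (g (Function.update p.1 a (Function.update (p.1 a) b p.2)))).card : ℝ))
        ≤ c * n / Real.log (2 * n) * (Fintype.card (Fin m → Fin k → Fin n × Bool) * (2 * n)) := by
    intro n m g hg hsη hn1
    have hzero : ∀ (a : Fin m) (b : Fin k),
        (((Finset.univ : Finset ((Fin m → Fin k → Fin n × Bool) × (Fin n × Bool))).filter
          fun p => η * n < hammingDist (g p.1)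
            (g (Function.update p.1 a (Function.update (p.1 a) b p.2)))).card : ℝ) = 0 := by
      intro a b
      rw [Nat.cast_eq_zero, Finset.card_eq_zero, Finset.filter_eq_empty_iff]
      intro p _
      exact not_lt.2 ((hg p.1 a b p.2).trans hsη)
    simp only [hzero, Finset.sum_const_zero]
    have h1 : (1 : ℝ) ≤ n := by exact_mod_cast hn1
    have hlog : 0 < Real.log (2 * n) := Real.log_pos (by linarith)
    positivity
  rcases Nat.lt_or_ge k 2 with hk | hk
  · -- degenerate widths k ≤ 1: α_k = 0, m = 0, and the smooth-fail body is contradictory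
    have hα0 : α = 0 := by
      rw [hαdef]
      interval_cases k <;> simp
    filter_upwards [hSF, eventually_ge_atTop 1] with n hSFn hn1 m hm g hg
    have hm' : m = ⌊α * n⌋₊ := hm
    have hm0 : m = 0 := by rw [hm', hα0, zero_mul, Nat.floor_zero]
    subst hm0
    exfalso
    have key := hSFn 0 hm g (by
      simp only [Finset.univ_eq_empty, Finset.sum_empty]
      have h1 : (1 : ℝ) ≤ n := by exact_mod_cast hn1
      have hlog : 0 < Real.log (2 * n) := Real.log_pos (by linarith)
      positivity)
    simp only [mul_zero, Nat.cast_zero, zero_mul] at key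
    have h1 : (1 : ℝ) ≤ n := by exact_mod_cast hn1
    have hlog : 0 < Real.log (2 * n) := Real.log_pos (by linarith)
    have : (0 : ℝ) ≤ c * n / Real.log (2 * n) * Fintype.card (Fin 0 → Fin k → Fin n × Bool) := by
      positivity
    linarith only [key, this]
  -- main case k ≥ 2
  have hkR : (2 : ℝ) ≤ k := by exact_mod_cast hk
  have hk0 : (0 : ℝ) < k := by linarith
  have hαpos : 0 < α := by
    rw [hαdef]
    have hlogk : 0 < Real.log k := Real.log_pos (by linarith)
    positivity
  set δ : ℝ := min 1 (min (ε * ν ^ 2 * α / (80 * k ^ 2)) (c * ν ^ 2 / (160 * k ^ 3))) with hδ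
  have hδpos : 0 < δ := by
    rw [hδ]
    refine lt_min zero_lt_one (lt_min ?_ ?_) <;> positivity
  have hδ1 : δ ≤ 1 := min_le_left _ _
  have hδa : δ ≤ ε * ν ^ 2 * α / (80 * k ^ 2) := (min_le_right _ _).trans (min_le_left _ _)
  have hδc : δ ≤ c * ν ^ 2 / (160 * k ^ 3) := (min_le_right _ _).trans (min_le_right _ _)
  -- eventual conditions
  have C0 : ∀ᶠ n : ℕ in atTop, 3 ≤ n := eventually_ge_atTop 3
  have C1 : ∀ᶠ n : ℕ in atTop, s n ^ 2 * Real.log n ^ 3 ≤ δ * n := by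
    filter_upwards [hs.def hδpos] with n hn
    rw [Real.norm_eq_abs, Real.norm_eq_abs, Nat.abs_cast] at hn
    exact (le_abs_self _).trans hn
  have C2 := shwL_sum_maxdeg_sq_le k hαpos.le
  have C3 : ∀ᶠ n : ℕ in atTop, (4 + ε * ν ^ 2) * 2 / (ε * ν ^ 2 * α) ≤ (n : ℝ) :=
    tendsto_natCast_atTop_atTop.eventually_ge_atTop _
  have C4 : ∀ᶠ n : ℕ in atTop, 8 * k * Real.log n ≤ c * ν ^ 2 * n / 2 := by
    have hlo := Real.isLittleO_log_id_atTop.comp_tendsto tendsto_natCast_atTop_atTop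
    have hpos : 0 < c * ν ^ 2 / (16 * k) := by positivity
    filter_upwards [hlo.def hpos] with n hn
    simp only [Function.comp_apply, id_eq, Real.norm_eq_abs, Nat.abs_cast] at hn
    have h1 : Real.log n ≤ c * ν ^ 2 / (16 * k) * n := (le_abs_self _).trans hn
    have h2 : 8 * k * Real.log n ≤ 8 * k * (c * ν ^ 2 / (16 * k) * n) :=
      mul_le_mul_of_nonneg_left h1 (by positivity)
    calc 8 * k * Real.log n ≤ 8 * k * (c * ν ^ 2 / (16 * k) * n) := h2
      _ = c * ν ^ 2 * n / 2 := by field_simp; ring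
  have C5 : ∀ᶠ n : ℕ in atTop, 1 / η ^ 2 ≤ (n : ℝ) :=
    tendsto_natCast_atTop_atTop.eventually_ge_atTop _
  filter_upwards [hSF, C0, C1, C2, C3, C4, C5] with n hSFn hn3 hC1 hC2 hC3 hC4 hC5 m hm g hg
  have hm' : m = ⌊α * n⌋₊ := hm
  -- numerics of n
  have hn1 : 1 ≤ n := le_trans (by norm_num) hn3
  have hnR : (1 : ℝ) ≤ n := by exact_mod_cast hn1
  have hn3R : (3 : ℝ) ≤ n := by exact_mod_cast hn3
  have hnpos : (0 : ℝ) < n := by linarith only [hnR]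
  have hlog1 : 1 ≤ Real.log n := by
    rw [← Real.log_exp 1]
    apply Real.log_le_log (Real.exp_pos 1)
    have : Real.exp 1 ≤ 3 := le_of_lt (lt_trans Real.exp_one_lt_d9 (by norm_num))
    exact this.trans hn3R
  have hlog2n : Real.log (2 * n) ≤ 2 * Real.log n := by
    rw [Real.log_mul two_ne_zero hnpos.ne']
    have : Real.log 2 ≤ Real.log n := Real.log_le_log two_pos (by linarith only [hn3R])
    linarith only [this]
  have hlog2npos : 0 < Real.log (2 * n) := Real.log_pos (by linarith only [hnR])
  -- the nonnegative Lipschitz constant s' = max (s n) 0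
  set s' : ℝ := max (s n) 0 with hs'
  have hs'0 : 0 ≤ s' := le_max_right _ _
  have hg' : ∀ (Φ : Fin m → Fin k → Fin n × Bool) (a : Fin m) (b : Fin k) (ℓ : Fin n × Bool),
      (hammingDist (g Φ) (g (Function.update Φ a (Function.update (Φ a) b ℓ))) : ℝ) ≤ s' :=
    fun Φ a b ℓ => (hg Φ a b ℓ).trans (le_max_left _ _)
  have hs'sq : s' ^ 2 ≤ s n ^ 2 := by
    rcases le_or_gt 0 (s n) with h | h
    · rw [hs', max_eq_left h]
    · rw [hs', max_eq_right h.le, zero_pow two_ne_zero]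
      exact sq_nonneg _
  have hs'cube : s' ^ 2 * Real.log n ^ 3 ≤ δ * n :=
    (mul_le_mul_of_nonneg_right hs'sq (by positivity)).trans hC1
  have hs'main : s' ^ 2 * Real.log n ^ 2 ≤ δ * n := by
    calc s' ^ 2 * Real.log n ^ 2 ≤ s' ^ 2 * Real.log n ^ 3 := by
          apply mul_le_mul_of_nonneg_left _ (sq_nonneg _)
          exact pow_le_pow_right₀ hlog1 (by norm_num)
      _ ≤ δ * n := hs'cube
  have hs'η : s' ≤ η * n := by
    have h1 : s' ^ 2 ≤ n := by
      calc s' ^ 2 = s' ^ 2 * 1 := by ring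
        _ ≤ s' ^ 2 * Real.log n ^ 3 := mul_le_mul_of_nonneg_left (one_le_pow₀ hlog1) (sq_nonneg _)
        _ ≤ δ * n := hs'cube
        _ ≤ 1 * n := mul_le_mul_of_nonneg_right hδ1 hnpos.le
        _ = n := one_mul _
    have h2 : (n : ℝ) ≤ (η * n) ^ 2 := by
      have hη2 : 0 < η ^ 2 := by positivity
      have : 1 ≤ η ^ 2 * n := by
        rw [div_le_iff₀ hη2] at hC5
        linarith only [hC5]
      calc (n : ℝ) = n * 1 := (mul_one _).symm
        _ ≤ n * (η ^ 2 * n) := mul_le_mul_of_nonneg_left this hnpos.le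
        _ = (η * n) ^ 2 := by ring
    exact (pow_le_pow_iff_left₀ hs'0 (by positivity) two_ne_zero).1 (h1.trans h2)
  have hsη : s n ≤ η * n := (le_max_left _ _).trans hs'η
  -- the smooth-fail consequence for g
  have key := hSFn m hm g (hjump n m g hg hsη hn1)
  by_contra hlt
  push Not at hlt
  rcases Nat.eq_zero_or_pos m with hm0 | hmpos
  · subst hm0
    simp only [mul_zero, Nat.cast_zero, zero_mul] at key
    have : (0 : ℝ) ≤ c * n / Real.log (2 * n) * Fintype.card (Fin 0 → Fin k → Fin n × Bool) := by
      positivity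
    linarith only [key, this]
  have hmR : (1 : ℝ) ≤ m := by exact_mod_cast hmpos
  have hmpos' : (0 : ℝ) < m := by linarith only [hmR]
  have hm_le : (m : ℝ) ≤ α * n := by
    rw [hm']; exact Nat.floor_le (by positivity)
  have hm_ge : α * n - 1 ≤ m := by
    rw [hm']; have := Nat.lt_floor_add_one (α * n); linarith only [this]
  haveI : Nonempty (Fin n × Bool) := ⟨(⟨0, hn1⟩, true)⟩
  set N : ℝ := (Fintype.card (Fin m → Fin k → Fin n × Bool) : ℝ) with hN
  have hNpos : 0 < N := by rw [hN]; exact_mod_cast Fintype.card_pos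
  -- File 1: second moment of the maximum clause-degree
  have hD := hC2 m hm_le
  -- File 2: Efron–Stein variance bound with the constant s'
  have hW := shwLip_sum_sq_dev_le hn1 g s' hs'0 hg'
  set SumD : ℝ := ∑ Φ : Fin m → Fin k → Fin n × Bool,
      (((univ : Finset (Fin n)).sup fun v =>
        ((univ : Finset (Fin m)).filter fun i => ∃ j, (Φ i j).1 = v).card : ℕ) : ℝ) ^ 2 with hSumD
  set B : ℝ := 1 + 10 * k ^ 2 * s' ^ 2 * Real.log n ^ 2 with hB
  set W : ℝ := m * (N + (k : ℝ) ^ 2 * s' ^ 2 * SumD) with hWdef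
  have hBpos : 0 < B := by rw [hB]; positivity
  have hWB : W ≤ m * N * B := by
    have h1 : (k : ℝ) ^ 2 * s' ^ 2 * SumD ≤ (k : ℝ) ^ 2 * s' ^ 2 * (10 * Real.log n ^ 2 * N) :=
      mul_le_mul_of_nonneg_left hD (by positivity)
    calc W = m * (N + (k : ℝ) ^ 2 * s' ^ 2 * SumD) := rfl
      _ ≤ m * (N + (k : ℝ) ^ 2 * s' ^ 2 * (10 * Real.log n ^ 2 * N)) := by gcongr
      _ = m * N * B := by rw [hB]; ring
  have hBbound : B ≤ 1 + 10 * k ^ 2 * (δ * n) := by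
    rw [hB]
    have : 10 * (k : ℝ) ^ 2 * (s' ^ 2 * Real.log n ^ 2) ≤ 10 * k ^ 2 * (δ * n) :=
      mul_le_mul_of_nonneg_left hs'main (by positivity)
    linarith only [this]
  -- (E1) the boost condition 4 W ≤ ε N (ν m)²
  have hE1 : 4 * W ≤ ε * N * (ν * m) ^ 2 := by
    have hten : 10 * (k : ℝ) ^ 2 * (δ * n) ≤ ε * ν ^ 2 * α * n / 8 := by
      have hk2 : (0 : ℝ) < 80 * k ^ 2 := by positivity
      have h := hδa
      rw [le_div_iff₀ hk2] at h
      have h' := mul_le_mul_of_nonneg_right h hnpos.le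
      linarith only [h']
    have hC3' : 4 + ε * ν ^ 2 ≤ ε * ν ^ 2 * α * n / 2 := by
      have hpos : 0 < ε * ν ^ 2 * α := by positivity
      have h := hC3
      rw [div_le_iff₀ hpos] at h
      linarith only [h]
    have h4B : 4 * B ≤ ε * ν ^ 2 * m := by
      have : ε * ν ^ 2 * (α * n - 1) ≤ ε * ν ^ 2 * m := mul_le_mul_of_nonneg_left hm_ge (by positivity)
      linarith only [hBbound, hten, hC3', this]
    calc 4 * W ≤ 4 * (m * N * B) := by linarith only [hWB]
      _ = (m * N) * (4 * B) := by ring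
      _ ≤ (m * N) * (ε * ν ^ 2 * m) := mul_le_mul_of_nonneg_left h4B (by positivity)
      _ = ε * N * (ν * m) ^ 2 := by ring
  -- the boost + Chebyshev step on the zero set = solved instances
  have hZ : ∀ Φ ∈ ((univ : Finset (Fin m → Fin k → Fin n × Bool)).filter
      fun Φ => ∀ i, ∃ j, g Φ (Φ i j).1 = (Φ i j).2),
      (fun Ψ : Fin m → Fin k → Fin n × Bool =>
        ((((univ : Finset (Fin m)).filter fun i => ∀ j, g Ψ (Ψ i j).1 ≠ (Ψ i j).2).card : ℕ) : ℝ)) Φ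
        = 0 := by
    intro Φ hΦ
    simp only [mem_filter, mem_univ, true_and] at hΦ
    simp only [Nat.cast_eq_zero, Finset.card_eq_zero, Finset.filter_eq_empty_iff]
    intro i _ hall
    obtain ⟨j, hj⟩ := hΦ i
    exact hall j hj
  have hV0 : ∀ Φ : Fin m → Fin k → Fin n × Bool, 0 ≤ (fun Ψ : Fin m → Fin k → Fin n × Bool =>
      ((((univ : Finset (Fin m)).filter fun i => ∀ j, g Ψ (Ψ i j).1 ≠ (Ψ i j).2).card : ℕ) : ℝ)) Φ :=
    fun Φ => Nat.cast_nonneg _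
  have hνm : 0 < ν * m := by positivity
  have hlt' : ε * (Fintype.card (Fin m → Fin k → Fin n × Bool) : ℝ)
      < (((univ : Finset (Fin m → Fin k → Fin n × Bool)).filter
          fun Φ => ∀ i, ∃ j, g Φ (Φ i j).1 = (Φ i j).2).card : ℝ) := hlt
  have hboost := shwLip_card_gt_le_of_zeroSet
    (fun Ψ : Fin m → Fin k → Fin n × Bool =>
      ((((univ : Finset (Fin m)).filter fun i => ∀ j, g Ψ (Ψ i j).1 ≠ (Ψ i j).2).card : ℕ) : ℝ))
    hV0 W ε (ν * m) hε hνm hW _ hZ hlt' hE1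
  -- combine with the smooth-fail consequence
  have hkey' : c * n / Real.log (2 * n) * N < ((k * m : ℕ) : ℝ) * (4 * W / (ν * m) ^ 2) := by
    calc c * n / Real.log (2 * n) * N < _ := key
      _ ≤ ((k * m : ℕ) : ℝ) * (4 * W / (ν * m) ^ 2) :=
          mul_le_mul_of_nonneg_left hboost (Nat.cast_nonneg _)
  -- (E2) but the right-hand side is within the budget
  have hE2 : ((k * m : ℕ) : ℝ) * (4 * W / (ν * m) ^ 2) ≤ c * n / Real.log (2 * n) * N := by
    have h1 : ((k * m : ℕ) : ℝ) * (4 * W / (ν * m) ^ 2) ≤ 4 * k * B * N / ν ^ 2 := by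
      push_cast
      have hm0' : (m : ℝ) ≠ 0 := hmpos'.ne'
      have hν0 : ν ≠ 0 := hν.ne'
      have hrew : (k : ℝ) * m * (4 * W / (ν * m) ^ 2) = 4 * k * W / (ν ^ 2 * m) := by
        field_simp
      rw [hrew, div_le_div_iff₀ (by positivity) (by positivity)]
      have : 4 * (k : ℝ) * W * ν ^ 2 ≤ 4 * k * (m * N * B) * ν ^ 2 := by
        have h4 : (0 : ℝ) ≤ 4 * k := by positivity
        have hν2 : (0 : ℝ) ≤ ν ^ 2 := by positivity
        exact mul_le_mul_of_nonneg_right (mul_le_mul_of_nonneg_left hWB h4) hν2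
      calc 4 * (k : ℝ) * W * ν ^ 2 ≤ 4 * k * (m * N * B) * ν ^ 2 := this
        _ = 4 * k * B * N * (ν ^ 2 * m) := by ring
    have h4kB : 4 * k * B * Real.log (2 * n) ≤ c * ν ^ 2 * n := by
      have hδ' : 80 * (k : ℝ) ^ 3 * δ ≤ c * ν ^ 2 / 2 := by
        have hk3 : (0 : ℝ) < 160 * k ^ 3 := by positivity
        have h := hδc
        rw [le_div_iff₀ hk3] at h
        linarith only [h]
      calc 4 * k * B * Real.log (2 * n) ≤ 4 * k * B * (2 * Real.log n) :=
            mul_le_mul_of_nonneg_left hlog2n (by positivity)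
        _ = 8 * k * Real.log n + 80 * k ^ 3 * (s' ^ 2 * Real.log n ^ 3) := by rw [hB]; ring
        _ ≤ c * ν ^ 2 * n / 2 + 80 * k ^ 3 * (δ * n) :=
            add_le_add hC4 (mul_le_mul_of_nonneg_left hs'cube (by positivity))
        _ ≤ c * ν ^ 2 * n := by
            have := mul_le_mul_of_nonneg_right hδ' hnpos.le
            linarith only [this]
    have h3 : 4 * k * B / ν ^ 2 ≤ c * n / Real.log (2 * n) := by
      rw [div_le_div_iff₀ (by positivity) hlog2npos]
      calc 4 * k * B * Real.log (2 * n) ≤ c * ν ^ 2 * n := h4kB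
        _ = c * n * ν ^ 2 := by ring
    have h2 : 4 * k * B * N / ν ^ 2 ≤ c * n / Real.log (2 * n) * N := by
      calc 4 * k * B * N / ν ^ 2 = (4 * k * B / ν ^ 2) * N := by ring
        _ ≤ (c * n / Real.log (2 * n)) * N := mul_le_mul_of_nonneg_right h3 hNpos.le
    exact h1.trans h2
  exact absurd (hkey'.trans_le hE2) (lt_irrefl _)

/-- **Strong Lipschitz rung, packaged over `k ≥ k₀`.** The hypothesis is, verbatim, the conclusion
of the route's smooth-maps-fail statement (`smoothMapsFail_of_noStableSection`, escalated seat 1,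
modulo crux `NoStableSection`); the conclusion is the hardness of EVERY Lipschitz search map
(`s(n)² log³ n = o(n)` output bits per single-literal change) at every constant success level `ε`. -/
theorem shwLip_lipschitzMapsFail_of_smoothMapsFail
    (hSMF : ∃ k₀ : ℕ, ∀ k : ℕ, k₀ ≤ k → ∃ η : ℝ, 0 < η ∧ ∃ ν : ℝ, 0 < ν ∧ ∃ c : ℝ, 0 < c ∧
      ∀ᶠ n : ℕ in Filter.atTop, ∀ m : ℕ, m = ⌊5 * 2 ^ k * Real.log k / k * n⌋₊ →
        ∀ g : (Fin m → Fin k → Fin n × Bool) → (Fin n → Bool),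
          (∑ a : Fin m, ∑ b : Fin k,
            (((Finset.univ : Finset ((Fin m → Fin k → Fin n × Bool) × (Fin n × Bool))).filter
              fun p => η * n < hammingDist (g p.1)
                (g (Function.update p.1 a (Function.update (p.1 a) b p.2)))).card : ℝ))
            ≤ c * n / Real.log (2 * n) * (Fintype.card (Fin m → Fin k → Fin n × Bool) * (2 * n)) →
          c * n / Real.log (2 * n) * Fintype.card (Fin m → Fin k → Fin n × Bool)
            < (k * m : ℕ) * ((Finset.univ.filter fun Φ : Fin m → Fin k → Fin n × Bool =>
                ν * m < ((Finset.univ.filter fun i : Fin m =>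
                  ∀ j, g Φ (Φ i j).1 ≠ (Φ i j).2).card : ℝ)).card : ℝ)) :
    ∃ k₀ : ℕ, ∀ k : ℕ, k₀ ≤ k → ∀ s : ℕ → ℝ,
      (fun n : ℕ => s n ^ 2 * Real.log n ^ 3) =o[atTop] (fun n : ℕ => (n : ℝ)) →
      ∀ ε : ℝ, 0 < ε → ∀ᶠ n : ℕ in atTop, ∀ m : ℕ, m = ⌊5 * 2 ^ k * Real.log k / k * n⌋₊ →
        ∀ g : (Fin m → Fin k → Fin n × Bool) → (Fin n → Bool),
          (∀ (Φ : Fin m → Fin k → Fin n × Bool) (a : Fin m) (b : Fin k) (ℓ : Fin n × Bool),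
            (hammingDist (g Φ) (g (Function.update Φ a (Function.update (Φ a) b ℓ))) : ℝ) ≤ s n) →
          ((Finset.univ.filter fun Φ : Fin m → Fin k → Fin n × Bool =>
              ∀ i, ∃ j, g Φ (Φ i j).1 = (Φ i j).2).card : ℝ)
            ≤ ε * Fintype.card (Fin m → Fin k → Fin n × Bool) := by
  obtain ⟨k₀, h⟩ := hSMF
  refine ⟨k₀, fun k hk s hs ε hε => ?_⟩
  obtain ⟨η, hη, ν, hν, c, hc, hSF⟩ := h k hk
  exact shwLip_successCount_le_of_smoothFail k η ν c hη hν hc hSF s hs ε hε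

end Summit.PneNP.PneNP.Theorems
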